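import Mathlib
import HarnessLib

/-!
# Crux `MayerPairing.BranchPairing` (stmt-RiemannHypothesis-1471), line `weinstein-aronszajn-pinning`:
gluing of continuous selections along the real line (helper of STUB 2b `finiteSetSelection_main`)

Route `RiemannHypothesis/MayerPairing`, crux `BranchPairing` (item stmt-RiemannHypothesis-1471), line
`weinstein-aronszajn-pinning`; supports 1471. First of three files proving the registered sub-goal
`finiteSetSelection_main` (Kato's theorem on continuous selections of eigenvalues, T. Kato,
*Perturbation theory for linear operators* (1966), II-§5.2 Thm. 5.2, in set form); this file is the
purely topological gluing layer and proves the registered helper sub-goal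
`finiteSetSelectionComponent_main`.

Setting: a set-valued map `S : ℝ → Set ℂ`, a "bad" set `G ⊆ ℝ`, and the **patch property off
`G`**: every `σ₀ ∉ G` has a patch `[σ₀ - η, σ₀ + η]` over which through every point of the graph of
`S` passes a continuous selection of `S` on the whole patch. Results:

* `continuousOn_ite_le_Icc` — gluing at a junction of two adjacent compact intervals;
* `exists_selection_Icc_of_mem_left` / `_right` — continuation of selections across a compact
  interval missing `G`, starting (supremum argument) or ending (infimum argument) at a prescribed
  point of the graph; `exists_selection_Icc_of_mem` — through any point;
  `exists_selection_extension_Icc` — extension of a given selection to a larger interval;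
* `exists_selection_component` (= `finiteSetSelectionComponent_main`) — for `G` closed with
  bounded complement: a selection through a given point, continuous at every point of its
  component in `ℝ ∖ G` (the component, an open interval, is exhausted by compact intervals and the
  selection is extended recursively).

No operator theory, no `ζ`: elementary real analysis only.
-/

open Set Filter Topology Metric

namespace Summit.RiemannHypothesis.RiemannHypothesis.Theorems.MayerPairingPinning

/-- Gluing two functions continuous on adjacent compact intervals `[x, y]`, `[y, z]` and agreeing
at `y`: the function `σ ↦ if σ ≤ y then f σ else g σ` is continuous on `[x, z]`. [folklore] -/
theorem continuousOn_ite_le_Icc {f g : ℝ → ℂ} {x y z : ℝ} (hf : ContinuousOn f (Icc x y))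
    (hg : ContinuousOn g (Icc y z)) (hfg : f y = g y) :
    ContinuousOn (fun σ => if σ ≤ y then f σ else g σ) (Icc x z) := by
  have h1 : ContinuousOn (fun σ => if σ ≤ y then f σ else g σ) (Icc x z ∩ Iic y) :=
    (hf.mono fun σ hσ => ⟨hσ.1.1, hσ.2⟩).congr fun σ hσ => if_pos hσ.2
  have h2 : ContinuousOn (fun σ => if σ ≤ y then f σ else g σ) (Icc x z ∩ Ici y) := by
    refine (hg.mono fun σ hσ => ⟨hσ.2, hσ.1.2⟩).congr fun σ hσ => ?_
    by_cases h : σ ≤ y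
    · have hσy : σ = y := le_antisymm h hσ.2
      simp [hσy, hfg]
    · simp [h]
  have h12 := h1.union_of_isClosed h2 (isClosed_Icc.inter isClosed_Iic)
    (isClosed_Icc.inter isClosed_Ici)
  rwa [← inter_union_distrib_left, Iic_union_Ici, inter_univ] at h12

/-- **Continuation to the right.** If off the closed-looking "bad" set `G` every point `σ₀` has a
patch `[σ₀ - η, σ₀ + η]` on which the set-valued map `S` admits a continuous selection through
every point of its graph, then over every compact interval `[x, y]` missing `G` there is a
continuous selection of `S` on `[x, y]` starting at any prescribed `ν ∈ S x` (supremum argument).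
[folklore] -/
theorem exists_selection_Icc_of_mem_left {S : ℝ → Set ℂ} {G : Set ℝ}
    (hloc : ∀ σ₀, σ₀ ∉ G → ∃ η > (0 : ℝ), ∀ σ' ∈ Icc (σ₀ - η) (σ₀ + η), ∀ μ' ∈ S σ',
      ∃ Λ : ℝ → ℂ, ContinuousOn Λ (Icc (σ₀ - η) (σ₀ + η)) ∧ Λ σ' = μ' ∧
        ∀ σ ∈ Icc (σ₀ - η) (σ₀ + η), Λ σ ∈ S σ)
    {x y : ℝ} (hxy : x ≤ y) (hG : ∀ t ∈ Icc x y, t ∉ G) {ν : ℂ} (hν : ν ∈ S x) :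
    ∃ Λ : ℝ → ℂ, ContinuousOn Λ (Icc x y) ∧ Λ x = ν ∧ ∀ σ ∈ Icc x y, Λ σ ∈ S σ := by
  -- `Q` = the right endpoints `t ∈ [x, y]` of a selection on `[x, t]` starting at `ν`
  set Q : Set ℝ := {t | t ∈ Icc x y ∧ ∃ Λ : ℝ → ℂ, ContinuousOn Λ (Icc x t) ∧ Λ x = ν ∧
    ∀ σ ∈ Icc x t, Λ σ ∈ S σ} with hQ
  have hxQ : x ∈ Q := ⟨left_mem_Icc.2 hxy, fun _ => ν, continuousOn_const, rfl, fun σ hσ => by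
    rw [Icc_self, mem_singleton_iff] at hσ; rw [hσ]; exact hν⟩
  have hQy : ∀ t ∈ Q, t ≤ y := fun t ht => ht.1.2
  have hbdd : BddAbove Q := ⟨y, hQy⟩
  have hne : Q.Nonempty := ⟨x, hxQ⟩
  set s := sSup Q with hs
  have hxs : x ≤ s := le_csSup hbdd hxQ
  have hsy : s ≤ y := csSup_le hne hQy
  obtain ⟨η, hη, hpatch⟩ := hloc s (hG s ⟨hxs, hsy⟩)
  obtain ⟨t, htQ, hst⟩ := exists_lt_of_lt_csSup hne (sub_lt_self s hη)
  have hts : t ≤ s := le_csSup hbdd htQ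
  obtain ⟨⟨hxt, hty⟩, Λ₁, hΛ₁c, hΛ₁x, hΛ₁S⟩ := htQ
  obtain ⟨Λ₂, hΛ₂c, hΛ₂t, hΛ₂S⟩ :=
    hpatch t ⟨hst.le, by linarith⟩ (Λ₁ t) (hΛ₁S t (right_mem_Icc.2 hxt))
  -- the glued selection reaches `u := min y (s + η)`
  have huQ : min y (s + η) ∈ Q := by
    refine ⟨⟨le_min (hxt.trans hty) (by linarith), min_le_left _ _⟩,
      fun σ => if σ ≤ t then Λ₁ σ else Λ₂ σ, ?_, by simp [hxt, hΛ₁x], fun σ hσ => ?_⟩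
    · exact continuousOn_ite_le_Icc hΛ₁c
        (hΛ₂c.mono (Icc_subset_Icc hst.le (min_le_right _ _))) hΛ₂t.symm
    · show (if σ ≤ t then Λ₁ σ else Λ₂ σ) ∈ S σ
      by_cases h : σ ≤ t
      · rw [if_pos h]; exact hΛ₁S σ ⟨hσ.1, h⟩
      · rw [if_neg h]
        exact hΛ₂S σ ⟨by linarith [not_le.1 h], hσ.2.trans (min_le_right _ _)⟩
  have hus : min y (s + η) ≤ s := le_csSup hbdd huQ
  rcases le_or_gt y (s + η) with h | h
  · rw [min_eq_left h] at huQ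
    exact huQ.2
  · rw [min_eq_right h.le] at hus
    linarith

/-- **Continuation to the left.** Mirror image of `exists_selection_Icc_of_mem_left`: over a
compact interval `[x, y]` missing `G` there is a continuous selection of `S` ending at any
prescribed `ν ∈ S y` (infimum argument). [folklore] -/
theorem exists_selection_Icc_of_mem_right {S : ℝ → Set ℂ} {G : Set ℝ}
    (hloc : ∀ σ₀, σ₀ ∉ G → ∃ η > (0 : ℝ), ∀ σ' ∈ Icc (σ₀ - η) (σ₀ + η), ∀ μ' ∈ S σ',
      ∃ Λ : ℝ → ℂ, ContinuousOn Λ (Icc (σ₀ - η) (σ₀ + η)) ∧ Λ σ' = μ' ∧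
        ∀ σ ∈ Icc (σ₀ - η) (σ₀ + η), Λ σ ∈ S σ)
    {x y : ℝ} (hxy : x ≤ y) (hG : ∀ t ∈ Icc x y, t ∉ G) {ν : ℂ} (hν : ν ∈ S y) :
    ∃ Λ : ℝ → ℂ, ContinuousOn Λ (Icc x y) ∧ Λ y = ν ∧ ∀ σ ∈ Icc x y, Λ σ ∈ S σ := by
  -- `Q` = the left endpoints `t ∈ [x, y]` of a selection on `[t, y]` ending at `ν`
  set Q : Set ℝ := {t | t ∈ Icc x y ∧ ∃ Λ : ℝ → ℂ, ContinuousOn Λ (Icc t y) ∧ Λ y = ν ∧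
    ∀ σ ∈ Icc t y, Λ σ ∈ S σ} with hQ
  have hyQ : y ∈ Q := ⟨right_mem_Icc.2 hxy, fun _ => ν, continuousOn_const, rfl, fun σ hσ => by
    rw [Icc_self, mem_singleton_iff] at hσ; rw [hσ]; exact hν⟩
  have hQx : ∀ t ∈ Q, x ≤ t := fun t ht => ht.1.1
  have hbdd : BddBelow Q := ⟨x, hQx⟩
  have hne : Q.Nonempty := ⟨y, hyQ⟩
  set s := sInf Q with hs
  have hsy : s ≤ y := csInf_le hbdd hyQ
  have hxs : x ≤ s := le_csInf hne hQx
  obtain ⟨η, hη, hpatch⟩ := hloc s (hG s ⟨hxs, hsy⟩)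
  obtain ⟨t, htQ, hst⟩ := exists_lt_of_csInf_lt hne (lt_add_of_pos_right s hη)
  have hts : s ≤ t := csInf_le hbdd htQ
  obtain ⟨⟨hxt, hty⟩, Λ₁, hΛ₁c, hΛ₁y, hΛ₁S⟩ := htQ
  obtain ⟨Λ₂, hΛ₂c, hΛ₂t, hΛ₂S⟩ :=
    hpatch t ⟨by linarith, hst.le⟩ (Λ₁ t) (hΛ₁S t (left_mem_Icc.2 hty))
  -- the glued selection reaches down to `u := max x (s - η)`
  have huQ : max x (s - η) ∈ Q := by
    refine ⟨⟨le_max_left _ _, max_le (hxt.trans hty) (by linarith)⟩,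
      fun σ => if σ ≤ t then Λ₂ σ else Λ₁ σ, ?_, ?_, fun σ hσ => ?_⟩
    · exact continuousOn_ite_le_Icc
        (hΛ₂c.mono (Icc_subset_Icc (le_max_right _ _) hst.le)) hΛ₁c hΛ₂t
    · show (if y ≤ t then Λ₂ y else Λ₁ y) = ν
      by_cases h : y ≤ t
      · obtain rfl : t = y := le_antisymm hty h
        rw [if_pos h, hΛ₂t, hΛ₁y]
      · rw [if_neg h, hΛ₁y]
    · show (if σ ≤ t then Λ₂ σ else Λ₁ σ) ∈ S σ
      by_cases h : σ ≤ t
      · rw [if_pos h]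
        exact hΛ₂S σ ⟨by linarith [le_max_right x (s - η), hσ.1], by linarith⟩
      · rw [if_neg h]; exact hΛ₁S σ ⟨(not_le.1 h).le, hσ.2⟩
  have hus : s ≤ max x (s - η) := csInf_le hbdd huQ
  rcases le_or_gt (s - η) x with h | h
  · rw [max_eq_left h] at huQ
    exact huQ.2
  · rw [max_eq_right h.le] at hus
    linarith

/-- **Selection through any point over a compact interval off `G`.** Combining the two
continuations: over `[x, y]` missing `G`, through every point `(σ', μ')` of the graph of `S` with
`σ' ∈ [x, y]` passes a continuous selection of `S` on `[x, y]`. [folklore] -/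
theorem exists_selection_Icc_of_mem {S : ℝ → Set ℂ} {G : Set ℝ}
    (hloc : ∀ σ₀, σ₀ ∉ G → ∃ η > (0 : ℝ), ∀ σ' ∈ Icc (σ₀ - η) (σ₀ + η), ∀ μ' ∈ S σ',
      ∃ Λ : ℝ → ℂ, ContinuousOn Λ (Icc (σ₀ - η) (σ₀ + η)) ∧ Λ σ' = μ' ∧
        ∀ σ ∈ Icc (σ₀ - η) (σ₀ + η), Λ σ ∈ S σ)
    {x y : ℝ} (hG : ∀ t ∈ Icc x y, t ∉ G) {σ' : ℝ} (hσ' : σ' ∈ Icc x y) {μ' : ℂ}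
    (hμ' : μ' ∈ S σ') :
    ∃ Λ : ℝ → ℂ, ContinuousOn Λ (Icc x y) ∧ Λ σ' = μ' ∧ ∀ σ ∈ Icc x y, Λ σ ∈ S σ := by
  obtain ⟨Λ₁, hΛ₁c, hΛ₁σ', hΛ₁S⟩ := exists_selection_Icc_of_mem_right hloc hσ'.1
    (fun t ht => hG t ⟨ht.1, ht.2.trans hσ'.2⟩) hμ'
  obtain ⟨Λ₂, hΛ₂c, hΛ₂σ', hΛ₂S⟩ := exists_selection_Icc_of_mem_left hloc hσ'.2
    (fun t ht => hG t ⟨hσ'.1.trans ht.1, ht.2⟩) hμ'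
  refine ⟨fun σ => if σ ≤ σ' then Λ₁ σ else Λ₂ σ,
    continuousOn_ite_le_Icc hΛ₁c hΛ₂c (hΛ₁σ'.trans hΛ₂σ'.symm), by simp [hΛ₁σ'], fun σ hσ => ?_⟩
  show (if σ ≤ σ' then Λ₁ σ else Λ₂ σ) ∈ S σ
  by_cases h : σ ≤ σ'
  · rw [if_pos h]; exact hΛ₁S σ ⟨hσ.1, h⟩
  · rw [if_neg h]; exact hΛ₂S σ ⟨(not_le.1 h).le, hσ.2⟩

/-- **Extension of a selection.** Over `[c', d']` missing `G`, a continuous selection of `S` given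
on a compact subinterval `[c, d]` extends to a continuous selection on `[c', d']`. [folklore] -/
theorem exists_selection_extension_Icc {S : ℝ → Set ℂ} {G : Set ℝ}
    (hloc : ∀ σ₀, σ₀ ∉ G → ∃ η > (0 : ℝ), ∀ σ' ∈ Icc (σ₀ - η) (σ₀ + η), ∀ μ' ∈ S σ',
      ∃ Λ : ℝ → ℂ, ContinuousOn Λ (Icc (σ₀ - η) (σ₀ + η)) ∧ Λ σ' = μ' ∧
        ∀ σ ∈ Icc (σ₀ - η) (σ₀ + η), Λ σ ∈ S σ)
    {c' c d d' : ℝ} (hc : c' ≤ c) (hcd : c ≤ d) (hd : d ≤ d') (hG : ∀ t ∈ Icc c' d', t ∉ G)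
    {s : ℝ → ℂ} (hsc : ContinuousOn s (Icc c d)) (hsS : ∀ σ ∈ Icc c d, s σ ∈ S σ) :
    ∃ s' : ℝ → ℂ, ContinuousOn s' (Icc c' d') ∧ (∀ σ ∈ Icc c' d', s' σ ∈ S σ) ∧
      ∀ σ ∈ Icc c d, s' σ = s σ := by
  obtain ⟨Λ₁, hΛ₁c, hΛ₁v, hΛ₁S⟩ := exists_selection_Icc_of_mem_right hloc hc
    (fun t ht => hG t ⟨ht.1, ht.2.trans (hcd.trans hd)⟩) (hsS c (left_mem_Icc.2 hcd))
  obtain ⟨Λ₂, hΛ₂c, hΛ₂v, hΛ₂S⟩ := exists_selection_Icc_of_mem_left hloc hd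
    (fun t ht => hG t ⟨(hc.trans hcd).trans ht.1, ht.2⟩) (hsS d (right_mem_Icc.2 hcd))
  -- first glue `Λ₁` and `s` at `c`, then the result and `Λ₂` at `d`
  set f : ℝ → ℂ := fun σ => if σ ≤ c then Λ₁ σ else s σ with hf
  have hfc : ContinuousOn f (Icc c' d) := continuousOn_ite_le_Icc hΛ₁c hsc hΛ₁v
  have hfs : ∀ σ ∈ Icc c d, f σ = s σ := fun σ hσ => by
    by_cases h : σ ≤ c
    · rw [hf]; dsimp only; rw [if_pos h, ← le_antisymm hσ.1 h, hΛ₁v]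
    · rw [hf]; dsimp only; rw [if_neg h]
  have hfS : ∀ σ ∈ Icc c' d, f σ ∈ S σ := fun σ hσ => by
    by_cases h : σ ≤ c
    · rw [hf]; dsimp only; rw [if_pos h]; exact hΛ₁S σ ⟨hσ.1, h⟩
    · rw [hf]; dsimp only; rw [if_neg h]; exact hsS σ ⟨(not_le.1 h).le, hσ.2⟩
  refine ⟨fun σ => if σ ≤ d then f σ else Λ₂ σ, continuousOn_ite_le_Icc hfc hΛ₂c
    ((hfs d (right_mem_Icc.2 hcd)).trans hΛ₂v.symm), fun σ hσ => ?_, fun σ hσ => ?_⟩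
  · show (if σ ≤ d then f σ else Λ₂ σ) ∈ S σ
    by_cases h : σ ≤ d
    · rw [if_pos h]; exact hfS σ ⟨hσ.1, h⟩
    · rw [if_neg h]; exact hΛ₂S σ ⟨(not_le.1 h).le, hσ.2⟩
  · show (if σ ≤ d then f σ else Λ₂ σ) = s σ
    rw [if_pos hσ.2, hfs σ hσ]

/-- **Selection over a whole component.** If `G` is closed with bounded complement and the
patch property holds off `G`, then through every point `(σ', μ')` of the graph of `S` with
`σ' ∉ G` passes a selection of `S` which is continuous at (and a selection at) every `τ` joined
to `σ'` by a segment missing `G` — i.e. on the whole component of `σ'` in `ℝ ∖ G`, an open interval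
exhausted by compact intervals along which a selection is extended recursively. [folklore] -/
theorem exists_selection_component {S : ℝ → Set ℂ} {G : Set ℝ} (hGc : IsClosed G) {p q : ℝ}
    (hbdd : ∀ σ, σ ∉ G → σ ∈ Icc p q)
    (hloc : ∀ σ₀, σ₀ ∉ G → ∃ η > (0 : ℝ), ∀ σ' ∈ Icc (σ₀ - η) (σ₀ + η), ∀ μ' ∈ S σ',
      ∃ Λ : ℝ → ℂ, ContinuousOn Λ (Icc (σ₀ - η) (σ₀ + η)) ∧ Λ σ' = μ' ∧
        ∀ σ ∈ Icc (σ₀ - η) (σ₀ + η), Λ σ ∈ S σ)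
    {σ' : ℝ} (hσ' : σ' ∉ G) {μ' : ℂ} (hμ' : μ' ∈ S σ') :
    ∃ Λ : ℝ → ℂ, Λ σ' = μ' ∧
      ∀ τ, (∀ t ∈ uIcc σ' τ, t ∉ G) → ContinuousAt Λ τ ∧ Λ τ ∈ S τ := by
  classical
  -- the component `C` of `σ'`
  set C : Set ℝ := {τ | ∀ t ∈ uIcc σ' τ, t ∉ G} with hC
  have hσ'C : σ' ∈ C := fun t ht => by
    rw [uIcc_self, mem_singleton_iff] at ht; rwa [ht]
  have hCG : ∀ τ ∈ C, τ ∉ G := fun τ hτ => hτ τ right_mem_uIcc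
  have hb1 : BddBelow C := ⟨p, fun τ hτ => (hbdd τ (hCG τ hτ)).1⟩
  have hb2 : BddAbove C := ⟨q, fun τ hτ => (hbdd τ (hCG τ hτ)).2⟩
  have hne : C.Nonempty := ⟨σ', hσ'C⟩
  have hCopen : ∀ τ ∈ C, ∃ ρ > (0 : ℝ), ball τ ρ ⊆ C := by
    intro τ hτ
    obtain ⟨ρ, hρ, hball⟩ := Metric.isOpen_iff.1 hGc.isOpen_compl τ (hCG τ hτ)
    refine ⟨ρ, hρ, fun τ' hτ' t ht => ?_⟩
    rcases uIcc_subset_uIcc_union_uIcc ht with h | h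
    · exact hτ t h
    · refine hball (mem_ball.2 (lt_of_le_of_lt ?_ (mem_ball.1 hτ')))
      rw [dist_comm t τ, dist_comm τ' τ]
      exact Real.dist_left_le_of_mem_uIcc h
  set l := sInf C with hl
  set r := sSup C with hr
  have hlC : l ∉ C := fun hlC => by
    obtain ⟨ρ, hρ, hball⟩ := hCopen l hlC
    have hmem : l - ρ / 2 ∈ C := hball (by
      rw [mem_ball, Real.dist_eq, show l - ρ / 2 - l = -(ρ / 2) by ring, abs_neg,
        abs_of_pos (half_pos hρ)]; exact half_lt_self hρ)
    linarith [csInf_le hb1 hmem]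
  have hrC : r ∉ C := fun hrC => by
    obtain ⟨ρ, hρ, hball⟩ := hCopen r hrC
    have hmem : r + ρ / 2 ∈ C := hball (by
      rw [mem_ball, Real.dist_eq, show r + ρ / 2 - r = ρ / 2 by ring, abs_of_pos (half_pos hρ)]
      exact half_lt_self hρ)
    linarith [le_csSup hb2 hmem]
  have hCI : ∀ τ ∈ C, l < τ ∧ τ < r := fun τ hτ =>
    ⟨lt_of_le_of_ne (csInf_le hb1 hτ) fun h => hlC (h ▸ hτ),
      lt_of_le_of_ne (le_csSup hb2 hτ) fun h => hrC (h ▸ hτ)⟩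
  have hIC : Ioo l r ⊆ C := by
    intro τ hτ t ht
    obtain ⟨c₁, hc₁C, hc₁τ⟩ := exists_lt_of_csInf_lt hne hτ.1
    obtain ⟨d₁, hd₁C, hτd₁⟩ := exists_lt_of_lt_csSup hne hτ.2
    rcases le_total σ' τ with h | h
    · exact hd₁C t (uIcc_subset_uIcc left_mem_uIcc (mem_uIcc_of_le h hτd₁.le) ht)
    · exact hc₁C t (uIcc_subset_uIcc left_mem_uIcc (mem_uIcc_of_ge hc₁τ.le h) ht)
  -- exhaustion of `(l, r)` by `[c k, d k]`
  obtain ⟨hlσ', hσ'r⟩ := hCI σ' hσ'C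
  set δ := min (σ' - l) (r - σ') with hδ
  have hδ0 : 0 < δ := lt_min (sub_pos.2 hlσ') (sub_pos.2 hσ'r)
  set c : ℕ → ℝ := fun k => l + δ / (k + 1) with hc
  set d : ℕ → ℝ := fun k => r - δ / (k + 1) with hd
  have hdivpos : ∀ k : ℕ, 0 < δ / (k + 1) := fun k => by positivity
  have hdivle : ∀ k : ℕ, δ / (k + 1) ≤ δ := fun k =>
    div_le_self hδ0.le (by norm_cast; omega)
  have hdivmono : ∀ j k : ℕ, j ≤ k → δ / (k + 1) ≤ δ / (j + 1) := fun j k hjk =>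
    div_le_div_of_nonneg_left hδ0.le (by positivity) (by norm_cast; omega)
  have hcσ' : ∀ k, c k ≤ σ' := fun k => by
    have := hdivle k; have := min_le_left (σ' - l) (r - σ'); simp only [hc]; linarith
  have hσ'd : ∀ k, σ' ≤ d k := fun k => by
    have := hdivle k; have := min_le_right (σ' - l) (r - σ'); simp only [hd]; linarith
  have hsub : ∀ j k, j ≤ k → Icc (c j) (d j) ⊆ Icc (c k) (d k) := fun j k hjk => by
    have := hdivmono j k hjk
    exact Icc_subset_Icc (by simp only [hc]; linarith) (by simp only [hd]; linarith)
  have hoff : ∀ k, ∀ t ∈ Icc (c k) (d k), t ∉ G := fun k t ht =>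
    hCG t (hIC ⟨by have := hdivpos k; simp only [hc] at ht; linarith [ht.1],
      by have := hdivpos k; simp only [hd] at ht; linarith [ht.2]⟩)
  -- the recursively extended selections `F k` on `[c k, d k]`
  obtain ⟨F0, hF0c, hF0v, hF0S⟩ :=
    exists_selection_Icc_of_mem hloc (hoff 0) ⟨hcσ' 0, hσ'd 0⟩ hμ'
  set F : ℕ → ℝ → ℂ := fun k => Nat.rec F0 (fun k Fk =>
    if h : ∃ g : ℝ → ℂ, (ContinuousOn g (Icc (c (k + 1)) (d (k + 1))) ∧
      ∀ σ ∈ Icc (c (k + 1)) (d (k + 1)), g σ ∈ S σ) ∧ ∀ σ ∈ Icc (c k) (d k), g σ = Fk σ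
    then h.choose else Fk) k with hF
  have hFsucc : ∀ k, F (k + 1) = if h : ∃ g : ℝ → ℂ, (ContinuousOn g (Icc (c (k + 1)) (d (k + 1)))
      ∧ ∀ σ ∈ Icc (c (k + 1)) (d (k + 1)), g σ ∈ S σ) ∧ ∀ σ ∈ Icc (c k) (d k), g σ = F k σ
    then h.choose else F k := fun k => rfl
  have hgood : ∀ k, (ContinuousOn (F k) (Icc (c k) (d k)) ∧ ∀ σ ∈ Icc (c k) (d k), F k σ ∈ S σ)
      ∧ ∀ σ ∈ Icc (c k) (d k), F (k + 1) σ = F k σ := by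
    intro k
    induction k with
    | zero =>
      have h0 : ContinuousOn (F 0) (Icc (c 0) (d 0)) ∧ ∀ σ ∈ Icc (c 0) (d 0), F 0 σ ∈ S σ :=
        ⟨hF0c, hF0S⟩
      have hex : ∃ g : ℝ → ℂ, (ContinuousOn g (Icc (c (0 + 1)) (d (0 + 1))) ∧
          ∀ σ ∈ Icc (c (0 + 1)) (d (0 + 1)), g σ ∈ S σ) ∧ ∀ σ ∈ Icc (c 0) (d 0), g σ = F 0 σ := by
        obtain ⟨g, hgc, hgS, hgeq⟩ := exists_selection_extension_Icc hloc
          (hsub 0 1 (by norm_num) (left_mem_Icc.2 ((hcσ' 0).trans (hσ'd 0)))).1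
          ((hcσ' 0).trans (hσ'd 0))
          (hsub 0 1 (by norm_num) (right_mem_Icc.2 ((hcσ' 0).trans (hσ'd 0)))).2
          (hoff 1) h0.1 h0.2
        exact ⟨g, ⟨hgc, hgS⟩, hgeq⟩
      refine ⟨h0, ?_⟩
      rw [hFsucc 0, dif_pos hex]
      exact hex.choose_spec.2
    | succ k ih =>
      have hexk : ∃ g : ℝ → ℂ, (ContinuousOn g (Icc (c (k + 1)) (d (k + 1))) ∧
          ∀ σ ∈ Icc (c (k + 1)) (d (k + 1)), g σ ∈ S σ) ∧ ∀ σ ∈ Icc (c k) (d k), g σ = F k σ := by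
        obtain ⟨g, hgc, hgS, hgeq⟩ := exists_selection_extension_Icc hloc
          (hsub k (k + 1) (by omega) (left_mem_Icc.2 ((hcσ' k).trans (hσ'd k)))).1
          ((hcσ' k).trans (hσ'd k))
          (hsub k (k + 1) (by omega) (right_mem_Icc.2 ((hcσ' k).trans (hσ'd k)))).2
          (hoff (k + 1)) ih.1.1 ih.1.2
        exact ⟨g, ⟨hgc, hgS⟩, hgeq⟩
      have hk1 : ContinuousOn (F (k + 1)) (Icc (c (k + 1)) (d (k + 1))) ∧
          ∀ σ ∈ Icc (c (k + 1)) (d (k + 1)), F (k + 1) σ ∈ S σ := by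
        rw [hFsucc k, dif_pos hexk]; exact hexk.choose_spec.1
      have hexk1 : ∃ g : ℝ → ℂ, (ContinuousOn g (Icc (c (k + 1 + 1)) (d (k + 1 + 1))) ∧
          ∀ σ ∈ Icc (c (k + 1 + 1)) (d (k + 1 + 1)), g σ ∈ S σ) ∧
          ∀ σ ∈ Icc (c (k + 1)) (d (k + 1)), g σ = F (k + 1) σ := by
        obtain ⟨g, hgc, hgS, hgeq⟩ := exists_selection_extension_Icc hloc
          (hsub (k + 1) (k + 1 + 1) (by omega)
            (left_mem_Icc.2 ((hcσ' (k + 1)).trans (hσ'd (k + 1))))).1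
          ((hcσ' (k + 1)).trans (hσ'd (k + 1)))
          (hsub (k + 1) (k + 1 + 1) (by omega)
            (right_mem_Icc.2 ((hcσ' (k + 1)).trans (hσ'd (k + 1))))).2
          (hoff (k + 1 + 1)) hk1.1 hk1.2
        exact ⟨g, ⟨hgc, hgS⟩, hgeq⟩
      refine ⟨hk1, ?_⟩
      rw [hFsucc (k + 1), dif_pos hexk1]
      exact hexk1.choose_spec.2
  -- compatibility along the chain
  have hchain : ∀ j k, j ≤ k → ∀ σ ∈ Icc (c j) (d j), F k σ = F j σ := by
    intro j k hjk
    induction k, hjk using Nat.le_induction with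
    | base => intro σ _; rfl
    | succ k hjk ih => intro σ hσ; rw [(hgood k).2 σ (hsub j k hjk hσ), ih σ hσ]
  -- the limit selection
  refine ⟨fun τ => if h : ∃ k, τ ∈ Icc (c k) (d k) then F (Nat.find h) τ else 0, ?_, ?_⟩
  · have h0 : ∃ k, σ' ∈ Icc (c k) (d k) := ⟨0, hcσ' 0, hσ'd 0⟩
    have hfind : Nat.find h0 = 0 := (Nat.find_eq_zero h0).2 ⟨hcσ' 0, hσ'd 0⟩
    simp only [dif_pos h0, hfind]
    exact hF0v
  · intro τ hτ
    -- `τ ∈ (c k, d k)` for some `k`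
    obtain ⟨hlτ, hτr⟩ := hCI τ hτ
    set m := min (τ - l) (r - τ) with hm
    have hm0 : 0 < m := lt_min (sub_pos.2 hlτ) (sub_pos.2 hτr)
    obtain ⟨k, hk⟩ := exists_nat_gt (δ / m)
    have hkm : δ / (k + 1) < m := by
      rw [div_lt_iff₀ (by positivity)]
      have h1 : δ < m * k := by rwa [div_lt_iff₀ hm0, mul_comm] at hk
      nlinarith
    have hτk : τ ∈ Ioo (c k) (d k) :=
      ⟨by have := min_le_left (τ - l) (r - τ); simp only [hc]; linarith,
        by have := min_le_right (τ - l) (r - τ); simp only [hd]; linarith⟩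
    have heq : ∀ σ ∈ Icc (c k) (d k),
        (fun τ => if h : ∃ k, τ ∈ Icc (c k) (d k) then F (Nat.find h) τ else 0) σ = F k σ := by
      intro σ hσ
      have h : ∃ k, σ ∈ Icc (c k) (d k) := ⟨k, hσ⟩
      dsimp only
      rw [dif_pos h]
      exact (hchain _ k (Nat.find_min' h hσ) σ (Nat.find_spec h)).symm
    have hnhds : Icc (c k) (d k) ∈ 𝓝 τ := Icc_mem_nhds hτk.1 hτk.2
    refine ⟨?_, ?_⟩
    · exact ((hgood k).1.1.continuousAt hnhds).congr
        (eventuallyEq_of_mem hnhds fun σ hσ => (heq σ hσ).symm)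
    · rw [heq τ (Ioo_subset_Icc_self hτk)]
      exact (hgood k).1.2 τ (Ioo_subset_Icc_self hτk)

/-- **Selection over a whole component** (registered helper sub-goal
`finiteSetSelectionComponent_main` of stmt-RiemannHypothesis-1471 = `exists_selection_component`
with all arguments explicit). For `G ⊆ ℝ` closed with bounded complement and `S : ℝ → Set ℂ` with
the patch property off `G`, through every point `(σ', μ')` of the graph of `S` with `σ' ∉ G` passes
a selection of `S` continuous at (and a selection at) every point joined to `σ'` by a segment
missing `G`. -/
theorem finiteSetSelectionComponent_main : ∀ (S : ℝ → Set ℂ) (G : Set ℝ) (p q : ℝ), IsClosed G → (∀ σ, σ ∉ G → σ ∈ Set.Icc p q) → (∀ σ₀, σ₀ ∉ G → ∃ η > (0 : ℝ), ∀ σ' ∈ Set.Icc (σ₀ - η) (σ₀ + η), ∀ μ' ∈ S σ', ∃ Λ : ℝ → ℂ, ContinuousOn Λ (Set.Icc (σ₀ - η) (σ₀ + η)) ∧ Λ σ' = μ' ∧ ∀ σ ∈ Set.Icc (σ₀ - η) (σ₀ + η), Λ σ ∈ S σ) → ∀ σ', σ' ∉ G → ∀ μ' ∈ S σ', ∃ Λ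 : ℝ → ℂ, Λ σ' = μ' ∧ ∀ τ, (∀ t ∈ Set.uIcc σ' τ, t ∉ G) → ContinuousAt Λ τ ∧ Λ τ ∈ S τ :=
  fun _ _ _ _ hGc hbdd hloc _ hσ' _ hμ' => exists_selection_component hGc hbdd hloc hσ' hμ'

end Summit.RiemannHypothesis.RiemannHypothesis.Theorems.MayerPairingPinning
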